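import Summits.Parity.GeneralizedHardyLittlewood.Theorems.LeeYangFibresRelativeDimOneSplitDefs
import Summits.Parity.GeneralizedHardyLittlewood.Theorems.LeeYangFibresRelativeDimOneSplitBrunTitchmarshAP
import Literature.NumberTheory.LFunctions.RHWave0PNTProofs
import HarnessLib

/-!
# Class variance from the sharp class second moment
(crux stmt-Parity-14113 `LeeYangFibres.RelativeDimOne`, line gallagher-backwards-split, aux for stub
`stub_classMoments`)

`classVariance_of_lowClassSecondMoment`: the HYPOTHESIS `LowClassSecondMoment θ₁`
(`∑_a ψ(x;q,a)² ≤ (1+ε)(x²/φ(q) + x log x)` for `q ≤ x^{θ₁}`), `θ₁ < 1`, implies that the class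
variance is `o(x²/φ(q))` uniformly in `1 ≤ q ≤ x^{θ₁}`:
`∑_{a mod q} (ψ(x;q,a) − 1_{(a,q)=1} x/φ(q))² ≤ ε x²/φ(q)` for `x ≥ x₀(ε)`.

Proof: expand the square; `∑_a ψ(x;q,a)²` is the hypothesis; the cross term is
`(x/φ(q)) ∑_{(a,q)=1} ψ(x;q,a) = (x/φ(q)) (ψ(x) − ∑_{n ≤ x, (n,q)>1} Λ(n))` with `ψ(x) ≥ (1-ε')x` by the
prime number theorem (`vonMangoldt_summatory_sub_isLittleO`, tree) and `∑_{(n,q)>1} Λ(n) ≤ 4 log³ x`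
(only powers of the `ω(q) ≤ log₂ q` primes dividing `q`); the constant term is `φ(q) (x/φ(q))²`. The
main terms `(1+ε') − 2(1−ε') + 1 = 3ε'` cancel to first order and the junk `(1+ε') x log x + 8x log³x/φ(q)`
is `≤ (ε/2) x²/φ(q)` because `φ(q) ≤ x^{θ₁} = o(x/log x)`.
-/

noncomputable section

open scoped BigOperators Classical Topology ArithmeticFunction.vonMangoldt
open Finset Filter Literature.NumberTheory.Sieve
open Summit.Parity.GeneralizedHardyLittlewood.Cruxes.RelativeDimOne.GallagherBackwards (classPsi)

namespace Summit.Parity.GeneralizedHardyLittlewood.Cruxes.RelativeDimOne.GallagherBackwardsSplit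

namespace ClassVariance

/-- Summing a function over the residue classes of `[1, x]` recovers the sum over `[1, x]`. -/
theorem sum_range_sum_class (x q : ℕ) (hq : 0 < q) (F : ℕ → ℝ) :
    ∑ a ∈ range q, ∑ n ∈ (Icc 1 x).filter (fun n => n % q = a), F n = ∑ n ∈ Icc 1 x, F n :=
  Finset.sum_fiberwise_of_maps_to (fun n _ => mem_range.2 (Nat.mod_lt n hq)) F

/-- `∑_{a mod q} ψ(x;q,a) = ψ(x)`. -/
theorem sum_classPsi (x q : ℕ) (hq : 0 < q) :
    ∑ a ∈ range q, classPsi x q a = ∑ n ∈ Icc 1 x, Λ n :=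
  sum_range_sum_class x q hq _

/-- `∑_{(a,q)=1} ψ(x;q,a) = ∑_{n ≤ x, (n,q)=1} Λ(n)`. -/
theorem sum_classPsi_coprime (x q : ℕ) (hq : 0 < q) :
    ∑ a ∈ range q, (if a.Coprime q then classPsi x q a else 0) =
      ∑ n ∈ (Icc 1 x).filter (fun n => n.Coprime q), Λ n := by
  -- `gcd(n, q) = gcd(n % q, q)`
  have coprime_mod_iff : ∀ n : ℕ, (n % q).Coprime q ↔ n.Coprime q := fun n => by
    rw [Nat.Coprime, Nat.Coprime, ← Nat.gcd_rec, Nat.gcd_comm]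
  have h : ∀ a ∈ range q, (if a.Coprime q then classPsi x q a else 0) =
      ∑ n ∈ (Icc 1 x).filter (fun n => n % q = a), (if n.Coprime q then (Λ n : ℝ) else 0) := by
    intro a _
    rw [classPsi]
    split_ifs with ha
    · refine sum_congr rfl fun n hn => ?_
      have hn' : n % q = a := (mem_filter.1 hn).2
      have : n.Coprime q := by rw [← coprime_mod_iff, hn']; exact ha
      rw [if_pos this]
    · symm
      refine sum_eq_zero fun n hn => ?_
      have hn' : n % q = a := (mem_filter.1 hn).2
      have : ¬ n.Coprime q := by rw [← coprime_mod_iff, hn']; exact ha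
      rw [if_neg this]
  rw [sum_congr rfl h, sum_range_sum_class x q hq, sum_filter]

/-- The non-coprime `Λ`-mass: `∑_{n ≤ x, (n,q)>1} Λ(n) ≤ 4 log³ x` for `1 ≤ q ≤ x`. -/
theorem sum_vonMangoldt_not_coprime_le {x q : ℕ} (hq : 0 < q) (hqx : q ≤ x) :
    ∑ n ∈ (Icc 1 x).filter (fun n => ¬ n.Coprime q), Λ n ≤ 4 * Real.log x ^ 3 := by
  have hmem : ∀ n ∈ (Icc 1 x).filter (fun n => ¬ n.Coprime q), Λ n ≠ 0 →
      n.minFac ∈ q.primeFactors := by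
    intro n hn hΛ
    obtain ⟨hp, hdvd⟩ := BrunTitchmarshAP.minFac_dvd_of_not_coprime hΛ (mem_filter.1 hn).2
    exact Nat.mem_primeFactors.2 ⟨hp, hdvd, hq.ne'⟩
  have h1 := BrunTitchmarshAP.sum_vonMangoldt_le_of_minFac_mem x q.primeFactors _
    (filter_subset _ _) hmem
  have hlogx : 0 ≤ Real.log x := Real.log_natCast_nonneg x
  have hω : (#q.primeFactors : ℝ) ≤ Nat.log 2 x := by
    exact_mod_cast (BrunTitchmarshAP.card_primeFactors_le_log hq).trans (Nat.log_mono_right hqx)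
  have hl2 : (Nat.log 2 x : ℝ) * Real.log x ≤ 2 * Real.log x ^ 2 :=
    BrunTitchmarshAP.natLog_two_mul_log_le x
  have h0 : (0 : ℝ) ≤ Nat.log 2 x := Nat.cast_nonneg _
  calc _ ≤ (#q.primeFactors : ℝ) * Nat.log 2 x * Real.log x := h1
    _ ≤ (Nat.log 2 x : ℝ) * Nat.log 2 x * Real.log x := by
        apply mul_le_mul_of_nonneg_right _ hlogx
        exact mul_le_mul_of_nonneg_right hω h0
    _ = (Nat.log 2 x : ℝ) * (Nat.log 2 x * Real.log x) := by ring
    _ ≤ (Nat.log 2 x : ℝ) * (2 * Real.log x ^ 2) := mul_le_mul_of_nonneg_left hl2 h0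
    _ = 2 * Real.log x * (Nat.log 2 x * Real.log x) := by ring
    _ ≤ 2 * Real.log x * (2 * Real.log x ^ 2) :=
        mul_le_mul_of_nonneg_left hl2 (by positivity)
    _ = 4 * Real.log x ^ 3 := by ring

/-- PNT lower bound `ψ(N) ≥ (1 - ε) N` for `N ≥ N₀(ε)` (Wiener–Ikehara, tree). -/
theorem exists_pnt_lower {ε : ℝ} (hε : 0 < ε) :
    ∃ N₀ : ℕ, ∀ N : ℕ, N₀ ≤ N → (1 - ε) * N ≤ ∑ n ∈ Icc 1 N, Λ n := by
  have h := Literature.NumberTheory.LFunctions.vonMangoldt_summatory_sub_isLittleO.def hε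
  rw [eventually_atTop] at h
  obtain ⟨N₀, hN₀⟩ := h
  refine ⟨N₀, fun N hN => ?_⟩
  have h1 := hN₀ N hN
  rw [Real.norm_eq_abs, Real.norm_of_nonneg (Nat.cast_nonneg N)] at h1
  have h2 := (abs_le.mp h1).1
  linarith

/-- `#{a < q : (a, q) = 1} = φ(q)` as a real sum of indicators. -/
theorem sum_indicator_coprime (q : ℕ) :
    ∑ a ∈ range q, (if a.Coprime q then (1 : ℝ) else 0) = Nat.totient q := by
  rw [Finset.sum_boole, Nat.totient_eq_card_coprime]
  congr 1
  exact congrArg Finset.card (filter_congr fun a _ => Nat.coprime_comm)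

/-- The junk is eventually small: for `θ₁ < 1`, `A ≥ 0` and `c > 0`, eventually in real `x`,
`A x^{θ₁} log x + 8 log³ x ≤ c x`. -/
theorem eventually_junk_le {θ₁ : ℝ} (hθ : θ₁ < 1) {A c : ℝ} (hA : 0 ≤ A) (hc : 0 < c) :
    ∀ᶠ x : ℝ in atTop, A * x ^ θ₁ * Real.log x + 8 * Real.log x ^ 3 ≤ c * x := by
  have e1 := (isLittleO_log_rpow_atTop (by linarith : (0 : ℝ) < 1 - θ₁)).def
    (by positivity : (0 : ℝ) < c / (2 * (A + 1)))
  have e2 := (isLittleO_log_rpow_rpow_atTop ((3 : ℕ) : ℝ) (by norm_num : (0 : ℝ) < 1)).def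
    (by positivity : (0 : ℝ) < c / 16)
  filter_upwards [e1, e2, eventually_ge_atTop (1 : ℝ)] with x h1 h2 hx1
  have hx0 : 0 < x := by linarith
  have hl : 0 ≤ Real.log x := Real.log_nonneg hx1
  rw [Real.norm_of_nonneg hl, Real.norm_of_nonneg (Real.rpow_nonneg hx0.le _)] at h1
  rw [Real.rpow_natCast, Real.rpow_one, Real.norm_of_nonneg (pow_nonneg hl 3),
    Real.norm_of_nonneg hx0.le] at h2
  have hsplit : x ^ θ₁ * x ^ (1 - θ₁) = x := by
    rw [← Real.rpow_add hx0]; norm_num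
  have hpow : 0 ≤ x ^ θ₁ := Real.rpow_nonneg hx0.le _
  have hA1 : 0 < A + 1 := by linarith
  have h3 : A * x ^ θ₁ * Real.log x ≤ c / 2 * x := by
    calc A * x ^ θ₁ * Real.log x ≤ A * x ^ θ₁ * (c / (2 * (A + 1)) * x ^ (1 - θ₁)) :=
          mul_le_mul_of_nonneg_left h1 (mul_nonneg hA hpow)
      _ = A / (A + 1) * (c / 2) * (x ^ θ₁ * x ^ (1 - θ₁)) := by
          field_simp
      _ = A / (A + 1) * (c / 2) * x := by rw [hsplit]
      _ ≤ 1 * (c / 2) * x := by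
          apply mul_le_mul_of_nonneg_right _ hx0.le
          apply mul_le_mul_of_nonneg_right _ (by positivity)
          rw [div_le_one hA1]; linarith
      _ = c / 2 * x := by ring
  linarith

end ClassVariance

open ClassVariance BrunTitchmarshAP in
/-- **Class variance from the sharp class second moment.** For `θ₁ < 1`, the hypothesis
`LowClassSecondMoment θ₁` implies: for every `ε > 0` there is `x₀` such that for all naturals `x ≥ x₀`
and all moduli `1 ≤ q ≤ x^{θ₁}`,
`∑_{a < q} (ψ(x;q,a) − 1_{(a,q)=1} · x/φ(q))² ≤ ε x²/φ(q)`.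
Registered auxiliary of stub `stub_classMoments`. -/
theorem classVariance_of_lowClassSecondMoment : ∀ θ₁ : ℝ, θ₁ < 1 → LowClassSecondMoment θ₁ → ∀ ε : ℝ, 0 < ε → ∃ x₀ : ℕ, ∀ x : ℕ, x₀ ≤ x → ∀ q : ℕ, 1 ≤ q → (q : ℝ) ≤ (x : ℝ) ^ θ₁ → ∑ a ∈ Finset.range q, (classPsi x q a - if a.Coprime q then (x : ℝ) / Nat.totient q else 0) ^ 2 ≤ ε * (x : ℝ) ^ 2 / Nat.totient q := by
  intro θ₁ hθ hL ε hε
  set ε' : ℝ := ε / 6 with hε'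
  have hε'0 : 0 < ε' := by positivity
  obtain ⟨N₁, hN₁⟩ := hL ε' hε'0
  obtain ⟨N₂, hN₂⟩ := exists_pnt_lower hε'0
  obtain ⟨N₃, hN₃⟩ := exists_nat_of_eventually
    ((eventually_junk_le hθ (by positivity : (0 : ℝ) ≤ 1 + ε') (by positivity : (0 : ℝ) < ε / 2)).and
      (eventually_ge_atTop (2 : ℝ)))
  refine ⟨max N₁ (max N₂ N₃), fun x hx q hq hqx => ?_⟩
  have hx1 : N₁ ≤ x := le_trans (le_max_left _ _) hx
  have hx2 : N₂ ≤ x := le_trans ((le_max_left _ _).trans (le_max_right _ _)) hx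
  have hx3 : N₃ ≤ x := le_trans ((le_max_right _ _).trans (le_max_right _ _)) hx
  obtain ⟨hjunk, hx2'⟩ := hN₃ x hx3
  have hx0 : (0 : ℝ) < x := by linarith
  have hxge1 : (1 : ℝ) ≤ x := by linarith
  have hq0 : 0 < q := hq
  have hφ0 : (0 : ℝ) < Nat.totient q := by exact_mod_cast Nat.totient_pos.2 hq0
  have hφq : (Nat.totient q : ℝ) ≤ q := by exact_mod_cast Nat.totient_le q
  -- `q ≤ x`
  have hqx' : (q : ℝ) ≤ x := by
    refine hqx.trans ?_
    have := Real.rpow_le_rpow_of_exponent_le hxge1 hθ.le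
    rwa [Real.rpow_one] at this
  have hqxN : q ≤ x := by exact_mod_cast hqx'
  -- abbreviations
  set φ : ℝ := (Nat.totient q : ℝ) with hφdef
  set M : ℝ := (x : ℝ) / φ with hM
  set S2 : ℝ := ∑ a ∈ range q, classPsi x q a ^ 2 with hS2
  set S1 : ℝ := ∑ a ∈ range q, (if a.Coprime q then classPsi x q a else 0) with hS1
  set ψx : ℝ := ∑ n ∈ Icc 1 x, (Λ n : ℝ) with hψx
  set B : ℝ := ∑ n ∈ (Icc 1 x).filter (fun n => ¬ n.Coprime q), (Λ n : ℝ) with hB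
  -- expansion of the square
  have hexp : ∑ a ∈ range q, (classPsi x q a - if a.Coprime q then (x : ℝ) / Nat.totient q else 0) ^ 2
      = S2 - 2 * M * S1 + M ^ 2 * φ := by
    have hpt : ∀ a ∈ range q,
        (classPsi x q a - if a.Coprime q then (x : ℝ) / Nat.totient q else 0) ^ 2 =
          classPsi x q a ^ 2 - 2 * M * (if a.Coprime q then classPsi x q a else 0) +
            M ^ 2 * (if a.Coprime q then (1 : ℝ) else 0) := by
      intro a _
      split_ifs <;> simp only [hM, hφdef] <;> ring
    rw [sum_congr rfl hpt, sum_add_distrib, sum_sub_distrib, ← mul_sum, ← mul_sum,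
      sum_indicator_coprime]
  -- the three inputs
  have hS2le : S2 ≤ (1 + ε') * ((x : ℝ) ^ 2 / φ + x * Real.log x) := hN₁ x hx1 q hq hqx
  have hS1eq : S1 = ψx - B := by
    rw [hS1, sum_classPsi_coprime x q hq0, hψx, hB, eq_sub_iff_add_eq]
    exact Finset.sum_filter_add_sum_filter_not _ _ _
  have hψlow : (1 - ε') * x ≤ ψx := hN₂ x hx2
  have hBle : B ≤ 4 * Real.log x ^ 3 := sum_vonMangoldt_not_coprime_le hq0 hqxN
  have hM0 : 0 ≤ M := by positivity
  have hlogx : 0 ≤ Real.log x := Real.log_natCast_nonneg x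
  -- junk control: `(1+ε') φ log x + 8 log³ x ≤ (ε/2) x`
  have hjunk' : (1 + ε') * φ * Real.log x + 8 * Real.log x ^ 3 ≤ ε / 2 * x := by
    have hφx : φ ≤ (x : ℝ) ^ θ₁ := hφq.trans hqx
    have : (1 + ε') * φ * Real.log x ≤ (1 + ε') * (x : ℝ) ^ θ₁ * Real.log x := by
      apply mul_le_mul_of_nonneg_right _ hlogx
      exact mul_le_mul_of_nonneg_left hφx (by positivity)
    linarith
  -- assemble
  rw [hexp, hS1eq]
  have hkey : (1 + ε') * (x * Real.log x) + 2 * M * B ≤ ε / 2 * (x : ℝ) ^ 2 / φ := by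
    have h1 : 2 * M * B ≤ 2 * M * (4 * Real.log x ^ 3) := by nlinarith
    have h2 : (1 + ε') * (x * Real.log x) + 2 * M * (4 * Real.log x ^ 3) =
        (x / φ) * ((1 + ε') * φ * Real.log x + 8 * Real.log x ^ 3) := by
      rw [hM]; field_simp; ring
    have h3 : (x / φ) * ((1 + ε') * φ * Real.log x + 8 * Real.log x ^ 3) ≤ (x / φ) * (ε / 2 * x) :=
      mul_le_mul_of_nonneg_left hjunk' hM0
    have h4 : (x / φ) * (ε / 2 * x) = ε / 2 * (x : ℝ) ^ 2 / φ := by field_simp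
    linarith
  have hmain : S2 - 2 * M * (ψx - B) + M ^ 2 * φ ≤
      3 * ε' * (x : ℝ) ^ 2 / φ + ((1 + ε') * (x * Real.log x) + 2 * M * B) := by
    have h1 : 2 * M * ((1 - ε') * x) ≤ 2 * M * ψx :=
      mul_le_mul_of_nonneg_left hψlow (by positivity)
    have h2 : M ^ 2 * φ = (x : ℝ) ^ 2 / φ := by rw [hM]; field_simp
    have h3 : 2 * M * ((1 - ε') * x) = 2 * (1 - ε') * ((x : ℝ) ^ 2 / φ) := by rw [hM]; field_simp
    have h4 : S2 - 2 * M * (ψx - B) + M ^ 2 * φ =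
        S2 - 2 * M * ψx + 2 * M * B + (x : ℝ) ^ 2 / φ := by rw [← h2]; ring
    have h5 : (1 + ε') * ((x : ℝ) ^ 2 / φ + x * Real.log x) =
        ((x : ℝ) ^ 2 / φ) + ε' * ((x : ℝ) ^ 2 / φ) + (1 + ε') * (x * Real.log x) := by ring
    have h6 : 3 * ε' * (x : ℝ) ^ 2 / φ = 3 * (ε' * ((x : ℝ) ^ 2 / φ)) := by ring
    rw [h4, h6]
    rw [h5] at hS2le
    rw [h3] at h1
    linarith
  calc S2 - 2 * M * (ψx - B) + M ^ 2 * φ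
      ≤ 3 * ε' * (x : ℝ) ^ 2 / φ + ((1 + ε') * (x * Real.log x) + 2 * M * B) := hmain
    _ ≤ 3 * ε' * (x : ℝ) ^ 2 / φ + ε / 2 * (x : ℝ) ^ 2 / φ := by linarith
    _ = ε * (x : ℝ) ^ 2 / φ := by rw [hε']; ring

end Summit.Parity.GeneralizedHardyLittlewood.Cruxes.RelativeDimOne.GallagherBackwardsSplit
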